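/-
Copyright (c) 2026. All rights reserved.
Released under Apache 2.0 license as described in the file LICENSE.
Authors: abc-iut cell, seat abc-iut-f-069 (gen 4; row «DPSC-NODAL-MODEL»).
-/
import Literature.AnabelianGeometry.AbsoluteAnabelian.AbsTopII.DehnTwistLoopDecomposition
import Literature.AnabelianGeometry.SemiGraphs.ProSigmaFreeFactorDisjoint
import Literature.AnabelianGeometry.SemiGraphs.ProSigmaCompletionRestrict
import Literature.AnabelianGeometry.SemiGraphs.PSCGraphicity
import Literature.GroupTheory.CombinatorialGroupTheory.FreeGroupTwoIndexTwo
import HarnessLib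

/-!
# [CombGC] Prop 1.2 (ii) for the verticial subgroup of the nodal Dehn-twist datum: `Π_v` is commensurably terminal

S. Mochizuki, *A combinatorial version of the Grothendieck conjecture* [CombGC] (`MochizukiCombGC2007`)
Prop 1.2 (ii) p. 8 ("`Π_v` is commensurably terminal in `Π_𝒢`"); consumed by *Topics in Absolute Anabelian
Geometry II* [AbsTopII] (`MochizukiAbsTopII2013`) Prop 1.3 (iii)/(v) p. 11–12 (`D_v ∩ Π_I = I_v × Π_v`, "`D_v ∩
Π_𝔾 = Π_v` is commensurably terminal").  Ribes–Zalesskii, *Profinite Groups*, Thm 9.1.12 (free factors of free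
pro-`𝒞` groups are malnormal) [cite: RibesZalesskii2010, Thm. 9.1.12].

PROOF-ONLY (no definition), abc-iut-f-069 (gen 4), row «DPSC-NODAL-MODEL» (abc-iut-L4-t6 g7 / abc-iut-f-069).
At the loop datum on `F̂₂ = ⟨a, b⟩^` (abc-iut-L4-t6's `DehnTwist.loopDatum`), the verticial representative is
`Π_v = vertGp = ⟨b^Ẑ ⊔ a·b^Ẑ·a⁻¹⟩^`.  It is NOT the closure of a free factor of `F(a,b)` — but it IS the closure of
the free factor `⟨b, aba⁻¹⟩` of the index-two subgroup `U = ⟨b, aba⁻¹, a²⟩ = Ker(χ : a ↦ 1, b ↦ 0 ∈ ℤ/2)`, free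
on these three elements (abc-iut-f-069's `freeGroupTwo_indexTwo_basis`, `FreeGroupTwoIndexTwo.lean`).  Route:
(1) `χ` extends continuously to `χ̂ : F̂₂ → ℤ/2`; `H := Ker χ̂` is open and `η⁻¹(H) = U`; (2) layer L3's
`IsProSigmaCompletion.restrict` + `of_comp_mulEquiv`: `η| ∘ j : F(x,y,z) → H` is a pro-(all primes) completion;
(3) layer L3's free-factor MALNORMALITY `freeFactor_eq_one_of_conj_mem` (`ProSigmaFreeFactorMalnormal`, the
Ribes–Zalesskii 9.1.12 engine) for the factor `⟨x,y⟩`, whose closure in `H` is `Π_v`: inside `H`, an element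
outside `Π_v` cannot conjugate a non-trivial element of `Π_v` into `Π_v`; (4) an element `g` commensurating `Π_v`
puts a power `b^n` (`n ≥ 1`) of the vanishing cycle into `g·Π_v·g⁻¹`; for `g ∈ H` this forces `g ∈ Π_v` by (3);
for `g ∉ H`, `u = a⁻¹g ∈ H` lies in `Π_v` by the same argument, whence `Π_v` and `a⁻¹Π_va` would be
commensurable and a power `(a⁻¹ba)^n = (a²)⁻¹(ab^na⁻¹)(a²)` would lie in `Π_v`, contradicting (3) for `a² ∈ H ∖ Π_v`.

* `isCommensurablyTerminal_vertGp` — **`Π_v` is commensurably terminal in `F̂₂`** (so `N(Π_v) = C(Π_v) = Π_v`);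
* `verticialEdgeLikeCommensurablyTerminal_loopDatum` — **[CombGC] Prop 1.2 (ii) (layer L3's
  `VerticialEdgeLikeCommensurablyTerminal`, FACT-LIST F-0438 shape) HOLDS for the loop datum** (vertex: this file;
  node `b^Ẑ` and cusp `c^Ẑ`: `DehnTwistFreeGroupInputs`), with no hypothesis;
* `prop_1_3_iii'_dpsc_holds'`, `prop_1_3_iii''_dpsc_holds` — **[AbsTopII] Prop 1.3 (iii) rest, the typed
  `Prop_1_3_iii'` (F-0299) and its scope successor `Prop_1_3_iii''`, HOLD at the nodal Dehn-twist datum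
  `dpsc i hi` IN FULL with no hypothesis** (the vertex clause "`D_v ∩ Π_I = I_v × Π_v`" was the last input,
  `prop_1_3_iii'_dpsc_of_normalizer_vertGp_eq`).
HONEST FRAMING: classical profinite group theory (free profinite groups) under OUR kernel check, at a constructed
model (constructed ≠ geometric); consistency evidence for the typed rows; nothing here bears on [IUTchIII]
Cor 3.12; no side taken.
-/

noncomputable section

open scoped Pointwise

namespace Literature.AnabelianGeometry.AbsoluteAnabelian.AbsTopII.DehnTwist

open Literature.AnabelianGeometry.EtaleTheta.SettingModel
open Literature.AnabelianGeometry.AbsoluteAnabelian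
open Literature.AnabelianGeometry.SemiGraphs
open Literature.GroupTheory.CombinatorialGroupTheory
open Function _root_.Topology

/-! ### Elementary facts about `F̂₂` used below -/

/-- A positive power of the vanishing cycle is non-trivial: `b^n ≠ 1` in `F̂₂` for `n ≠ 0` (the `b`-exponent
character `F(a,b) → ℤ` and injectivity of `η`). [cite: MochizukiAbsTopII2013, Prop 1.3 (ii) p.11] -/
theorem genB_pow_ne_one {n : ℕ} (hn : n ≠ 0) : (eta (FreeGroup.of 1) : F₂hatT) ^ n ≠ 1 := by
  intro h
  rw [← map_pow] at h
  have h1 : (FreeGroup.of (1 : Fin 2)) ^ n = 1 := eta_injective (h.trans (map_one eta).symm)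
  let deg : FreeGroup (Fin 2) →* Multiplicative ℤ :=
    FreeGroup.lift fun i => if i = 1 then Multiplicative.ofAdd 1 else 1
  have h2 := congrArg deg h1
  rw [map_pow, map_one] at h2
  have h3 : deg (FreeGroup.of 1) = Multiplicative.ofAdd 1 := by simp [deg]
  rw [h3, ← ofAdd_nsmul, nsmul_eq_mul, mul_one] at h2
  have h4 : (n : ℤ) = 0 := Multiplicative.ofAdd.injective (h2.trans ofAdd_zero.symm)
  exact hn (by exact_mod_cast h4)

/-- `Π_v` lies in the kernel of the `a`-degree `ê : F̂₂ → Ẑ`. [cite: MochizukiAbsTopII2013, Ex 1.1 (ii) p.9] -/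
theorem eHat_eq_one_of_mem_vertGp {x : F₂hatT} (hx : x ∈ vertGp) : eHat x = 1 := by
  have hle : (bAxis ⊔ MulAut.conj genA • bAxis : Subgroup F₂hatT) ≤ eHat.toMonoidHom.ker := by
    refine sup_le (fun s hs => ?_) (fun s hs => ?_)
    · exact eHat_eq_one_of_mem_bAxis hs
    · rw [Subgroup.mem_smul_pointwise_iff_exists] at hs
      obtain ⟨t, ht, rfl⟩ := hs
      rw [MonoidHom.mem_ker, MulAut.smul_def, MulAut.conj_apply]
      change eHat (genA * t * genA⁻¹) = 1
      rw [map_mul, map_mul, map_inv, eHat_eq_one_of_mem_bAxis ht, mul_one, mul_inv_cancel]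
  have hcl : IsClosed ((eHat.toMonoidHom.ker : Subgroup F₂hatT) : Set F₂hatT) := by
    rw [MonoidHom.coe_ker]
    exact isClosed_singleton.preimage eHat.continuous
  exact Subgroup.topologicalClosure_minimal _ hle hcl hx

/-- `a² ∉ Π_v` (its `a`-degree is `2 ≠ 0`). [cite: MochizukiAbsTopII2013, Ex 1.1 (ii) p.9] -/
theorem genA_sq_not_mem_vertGp : genA * genA ∉ vertGp := by
  intro h
  have h1 := eHat_eq_one_of_mem_vertGp h
  rw [map_mul] at h1
  change eHat (eta (FreeGroup.of 0)) * eHat (eta (FreeGroup.of 0)) = 1 at h1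
  rw [eHat_eta, expA_of_zero, ← map_mul, ← ofAdd_add] at h1
  have h2 := iotaZ_injective (h1.trans (map_one iotaZ).symm)
  exact absurd (Multiplicative.ofAdd.injective h2) (by norm_num)

/-- `b ∈ Π_v`. [cite: MochizukiCombGC2007, Def 1.1(ii) p.6] -/
theorem genB_mem_vertGp : genB ∈ vertGp :=
  Subgroup.le_topologicalClosure _ (Subgroup.mem_sup_left eta_of_one_mem_bAxis)

/-- `a b a⁻¹ ∈ Π_v`. [cite: MochizukiCombGC2007, Def 1.1(ii) p.6] -/
theorem conj_genB_mem_vertGp : genA * genB * genA⁻¹ ∈ vertGp := by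
  refine Subgroup.le_topologicalClosure _ (Subgroup.mem_sup_right ?_)
  rw [Subgroup.mem_smul_pointwise_iff_exists]
  exact ⟨genB, eta_of_one_mem_bAxis, by rw [MulAut.smul_def, MulAut.conj_apply]⟩

/-- Commensurable subgroups: every element of `L` has a positive power in `K`.
[cite: MochizukiAbsAnab2004, Def 0.1 (iii) p.4] -/
theorem exists_pow_mem_of_commensurable {G : Type*} [Group G] {K L : Subgroup G}
    (h : Subgroup.Commensurable K L) {t : G} (ht : t ∈ L) : ∃ n : ℕ, 0 < n ∧ t ^ n ∈ K := by
  obtain ⟨n, hn, -, hmem⟩ := (K.subgroupOf L).exists_pow_mem_of_index_ne_zero h.1 ⟨t, ht⟩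
  refine ⟨n, hn, ?_⟩
  rw [Subgroup.mem_subgroupOf] at hmem
  exact hmem

/-! ### The vertex group is commensurably terminal -/

/-- **[CombGC] Prop 1.2 (ii) at the loop datum, vertex: `Π_v = ⟨b^Ẑ ⊔ a·b^Ẑ·a⁻¹⟩^` is commensurably terminal in
`F̂₂`.**  (`Π_v` is the closure of the free factor `⟨b, aba⁻¹⟩` of the free index-two subgroup
`⟨b, aba⁻¹, a²⟩`; free-factor malnormality in the pro-completion of that subgroup, plus the coset argument for
elements of odd `a`-degree.) [cite: MochizukiCombGC2007, Prop 1.2 p.8] [cite: RibesZalesskii2010, Thm. 9.1.12] -/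
theorem isCommensurablyTerminal_vertGp : IsCommensurablyTerminal vertGp := by
  classical
  -- (0) the discrete index-two subgroup and its Schreier basis
  obtain ⟨j, hjinj, hjx, hjy, hjz, hjrange⟩ := freeGroupTwo_indexTwo_basis
  set χ : FreeGroup (Fin 2) →* Multiplicative (ZMod 2) :=
    FreeGroup.lift fun i : Fin 2 => if i = 0 then Multiplicative.ofAdd (1 : ZMod 2) else 1 with hχdef
  obtain ⟨hχb, hχaba, hχaa, hχa⟩ := lift_chi_apply_generators
  -- (1) the continuous extension `χ̂ : F̂₂ → ℤ/2` and the open subgroup `H = Ker χ̂`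
  letI : TopologicalSpace (Multiplicative (ZMod 2)) := ⊥
  haveI : DiscreteTopology (Multiplicative (ZMod 2)) := ⟨rfl⟩
  obtain ⟨χh, hχh⟩ := exists_continuousMonoidHom_extend F₂ (Multiplicative (ZMod 2)) χ
  have hχh' : ∀ g : F₂, χh (eta g) = χ g := fun g => hχh g
  set H : Subgroup F₂hatT := χh.toMonoidHom.ker with hHdef
  have hmemH : ∀ x : F₂hatT, x ∈ H ↔ χh x = 1 := fun x => MonoidHom.mem_ker
  have hHopen : IsOpen (H : Set F₂hatT) := by
    rw [hHdef, MonoidHom.coe_ker]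
    exact (isOpen_discrete _).preimage χh.continuous
  have hHclosed : IsClosed (H : Set F₂hatT) := Subgroup.isClosed_of_isOpen H hHopen
  haveI : CompactSpace H := isCompact_iff_compactSpace.mp hHclosed.isCompact
  have hHcomap : H.comap eta = j.range := by
    rw [hjrange]
    ext g
    rw [Subgroup.mem_comap, hmemH, hχh', MonoidHom.mem_ker]
  -- membership of the named elements
  have haH : genA ∉ H := by
    rw [hmemH]
    change χh (eta (FreeGroup.of 0)) ≠ 1
    rw [hχh', hχa]
    decide
  have haaH : genA * genA ∈ H := by
    rw [hmemH]
    change χh (eta (FreeGroup.of 0) * eta (FreeGroup.of 0)) = 1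
    rw [← map_mul, hχh', hχaa]
  have hVH : vertGp ≤ H := by
    have hle : (bAxis ⊔ MulAut.conj genA • bAxis : Subgroup F₂hatT) ≤ H := by
      have hb : bAxis ≤ H := by
        rw [bAxis_eq_closure_zpowers]
        refine Subgroup.topologicalClosure_minimal _ ?_ hHclosed
        rw [Subgroup.zpowers_le, hmemH, hχh']
        exact hχb
      refine sup_le hb ?_
      intro s hs
      rw [Subgroup.mem_smul_pointwise_iff_exists] at hs
      obtain ⟨t, ht, rfl⟩ := hs
      rw [MulAut.smul_def, MulAut.conj_apply]
      exact (MonoidHom.normal_ker χh.toMonoidHom).conj_mem t (hb ht) genA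
    exact Subgroup.topologicalClosure_minimal _ hle hHclosed
  -- if `g ∉ H` then `a⁻¹ g ∈ H` (`ℤ/2` has two elements)
  have hcoset : ∀ g : F₂hatT, g ∉ H → genA⁻¹ * g ∈ H := by
    intro g hg
    rw [hmemH] at hg ⊢
    rw [map_mul, map_inv]
    change (χh (eta (FreeGroup.of 0)))⁻¹ * χh g = 1
    rw [hχh', hχa]
    have h2 : ∀ t : Multiplicative (ZMod 2), t ≠ 1 → t = Multiplicative.ofAdd 1 := by decide
    rw [h2 _ hg]
    decide
  -- (2) `η| ∘ j : F₃ → H` is a pro-(all primes) completion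
  have hι : SemiGraphOfAnabelioids.IsProSigmaCompletion {p : ℕ | p.Prime} eta :=
    SemiGraphOfAnabelioids.IsProSigmaCompletion.isProSigmaCompletion_toCompletion F₂
  have hres := hι.restrict H hHopen
  let e : FreeGroup (Fin 3) ≃* ↥(H.comap eta) :=
    (MonoidHom.ofInjective hjinj).trans (MulEquiv.subgroupCongr hHcomap.symm)
  have he : ∀ w, ((e w : ↥(H.comap eta)) : FreeGroup (Fin 2)) = j w := fun w => rfl
  let ι' : FreeGroup (Fin 3) →* ↥H := (eta.subgroupComap H).comp e.toMonoidHom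
  have hι'val : ∀ w, ((ι' w : ↥H) : F₂hatT) = eta (j w) := fun w => rfl
  have hι' : SemiGraphOfAnabelioids.IsProSigmaCompletion {p : ℕ | p.Prime} ι' :=
    SemiGraphOfAnabelioids.IsProSigmaCompletion.of_comp_mulEquiv e (fun _ => rfl) hres
  -- (3) the free factor `⟨x, y⟩` and its closure `A` in `H`; `A` "is" `Π_v`
  let bF := FreeGroupBasis.ofFreeGroup (Fin 3)
  let S : Set (Fin 3) := {0, 1}
  set A : Subgroup ↥H := ((Subgroup.closure (bF '' S)).map ι').topologicalClosure with hAdef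
  have hS : bF '' S = {FreeGroup.of 0, FreeGroup.of 1} := by
    ext w
    simp only [S, Set.mem_image, Set.mem_insert_iff, Set.mem_singleton_iff, bF, FreeGroupBasis.ofFreeGroup_apply]
    constructor
    · rintro ⟨i, (rfl | rfl), rfl⟩
      · exact Or.inl rfl
      · exact Or.inr rfl
    · rintro (rfl | rfl)
      · exact ⟨0, Or.inl rfl, rfl⟩
      · exact ⟨1, Or.inr rfl, rfl⟩
  -- the image of `A` in `F̂₂` is `Π_v`
  have hAmap : A.map H.subtype = vertGp := by
    have h1 : ((Subgroup.closure (bF '' S)).map ι').map H.subtype =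
        Subgroup.closure {genB, genA * genB * genA⁻¹} := by
      rw [Subgroup.map_map, MonoidHom.map_closure, hS]
      congr 1
      ext w
      simp only [Set.image_insert_eq, Set.image_singleton, Set.mem_insert_iff, Set.mem_singleton_iff,
        MonoidHom.comp_apply, Subgroup.coe_subtype]
      rw [hι'val, hι'val, hjx, hjy, map_mul, map_mul, map_inv]
    have h2 : (A.map H.subtype : Set F₂hatT) = closure ((((Subgroup.closure (bF '' S)).map ι').map H.subtype :
        Subgroup F₂hatT) : Set F₂hatT) := by
      simp only [hAdef, Subgroup.coe_map, Subgroup.topologicalClosure_coe, Subgroup.coe_subtype]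
      exact (hHclosed.isClosedEmbedding_subtypeVal.closure_image_eq _).symm
    apply SetLike.coe_injective
    rw [h2, h1]
    change closure _ = ((bAxis ⊔ MulAut.conj genA • bAxis).topologicalClosure : Set F₂hatT)
    rw [Subgroup.topologicalClosure_coe]
    apply le_antisymm
    · refine closure_mono ?_
      change Subgroup.closure {genB, genA * genB * genA⁻¹} ≤ bAxis ⊔ MulAut.conj genA • bAxis
      rw [Subgroup.closure_le]
      rintro w (rfl | rfl)
      · exact Subgroup.mem_sup_left eta_of_one_mem_bAxis
      · refine Subgroup.mem_sup_right ?_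
        rw [Subgroup.mem_smul_pointwise_iff_exists]
        exact ⟨genB, eta_of_one_mem_bAxis, by rw [MulAut.smul_def, MulAut.conj_apply]⟩
    · -- `bAxis ⊔ a·bAxis·a⁻¹ ≤ closure ⟨b, aba⁻¹⟩` since that closure is a closed subgroup containing `b`, `aba⁻¹`
      have hT : (bAxis ⊔ MulAut.conj genA • bAxis : Subgroup F₂hatT) ≤
          (Subgroup.closure {genB, genA * genB * genA⁻¹}).topologicalClosure := by
        have hb' : bAxis ≤ (Subgroup.closure {genB, genA * genB * genA⁻¹}).topologicalClosure := by
          rw [bAxis_eq_closure_zpowers]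
          refine Subgroup.topologicalClosure_mono ?_
          rw [Subgroup.zpowers_le]
          exact Subgroup.subset_closure (Set.mem_insert _ _)
        refine sup_le hb' ?_
        intro s hs
        rw [Subgroup.mem_smul_pointwise_iff_exists] at hs
        obtain ⟨t, ht, rfl⟩ := hs
        -- `{t | a t a⁻¹ ∈ T}` is a closed subgroup containing `zpowers b`
        have hcont : Continuous fun w : F₂hatT => MulAut.conj genA • w :=
          (continuous_const.mul continuous_id).mul continuous_const
        have hpre : bAxis ≤ ((Subgroup.closure {genB, genA * genB * genA⁻¹}).topologicalClosure).comap
            (MulAut.conj genA).toMonoidHom := by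
          rw [bAxis_eq_closure_zpowers]
          refine Subgroup.topologicalClosure_minimal _ ?_ ?_
          · rw [Subgroup.zpowers_le, Subgroup.mem_comap]
            exact Subgroup.le_topologicalClosure _ (Subgroup.subset_closure (Set.mem_insert_of_mem _ rfl))
          · exact (Subgroup.isClosed_topologicalClosure _).preimage hcont
        exact hpre ht
      calc closure ((bAxis ⊔ MulAut.conj genA • bAxis : Subgroup F₂hatT) : Set F₂hatT)
          ⊆ closure (((Subgroup.closure {genB, genA * genB * genA⁻¹}).topologicalClosure : Subgroup F₂hatT) :
              Set F₂hatT) := closure_mono hT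
        _ = _ := by rw [(Subgroup.isClosed_topologicalClosure _).closure_eq, Subgroup.topologicalClosure_coe]
  have hAmem : ∀ h : ↥H, h ∈ A ↔ (h : F₂hatT) ∈ vertGp := by
    intro h
    rw [← hAmap, ← Subgroup.coe_subtype, Subgroup.mem_map_iff_mem H.subtype_injective]
  -- (4) the malnormality engine, read in `F̂₂`: for `x ∈ H ∖ Π_v`, `z ∈ Π_v`, `x z x⁻¹ ∈ Π_v ⇒ z = 1`
  have hmal : ∀ x z : F₂hatT, x ∈ H → x ∉ vertGp → z ∈ vertGp → x * z * x⁻¹ ∈ vertGp → z = 1 := by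
    intro x z hxH hxV hzV hxz
    have hzH : z ∈ H := hVH hzV
    have h := SemiGraphOfAnabelioids.IsProSigmaCompletion.freeFactor_eq_one_of_conj_mem (P := ↥H)
      (Sigma := {p : ℕ | p.Prime}) bF S hι' (x := ⟨x, hxH⟩) (z := ⟨z, hzH⟩)
      (by rw [hAmem]; exact hxV) (by rw [hAmem]; exact hzV) (by rw [hAmem]; exact hxz)
    exact congrArg Subtype.val h
  -- powers of `b` conjugated into `Π_v` force membership
  have hkey : ∀ x : F₂hatT, x ∈ H → (∃ n : ℕ, 0 < n ∧ x * genB ^ n * x⁻¹ ∈ vertGp) → x ∈ vertGp := by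
    intro x hxH ⟨n, hn, hmem⟩
    by_contra hxV
    exact genB_pow_ne_one (Nat.pos_iff_ne_zero.mp hn) (hmal x _ hxH hxV (Subgroup.pow_mem _ genB_mem_vertGp n) hmem)
  -- (5) the commensurator computation
  refine isCommensurablyTerminal_of_forall fun g hg => ?_
  -- a positive power of `b` lies in `g Π_v g⁻¹`
  by_cases hgH : g ∈ H
  · obtain ⟨n, hn, hbn⟩ := exists_pow_mem_of_commensurable hg genB_mem_vertGp
    rw [Subgroup.mem_smul_pointwise_iff_exists] at hbn
    obtain ⟨t, ht, hgt⟩ := hbn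
    rw [MulAut.smul_def, MulAut.conj_apply] at hgt
    have hmem : g⁻¹ * genB ^ n * g⁻¹⁻¹ ∈ vertGp := by
      rw [inv_inv, ← hgt]
      rw [show g⁻¹ * (g * t * g⁻¹) * g = t by group]
      exact ht
    have := hkey g⁻¹ (H.inv_mem hgH) ⟨n, hn, hmem⟩
    exact (Subgroup.inv_mem_iff _).mp this
  · exfalso
    set u := genA⁻¹ * g with hu
    have huH : u ∈ H := hcoset g hgH
    -- `Commensurable (u Π_v u⁻¹) (a⁻¹ Π_v a)`
    have hg' : Subgroup.Commensurable (MulAut.conj u • vertGp) (MulAut.conj genA⁻¹ • vertGp) := by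
      have h := (Subgroup.Commensurable.commensurable_conj (ConjAct.toConjAct genA⁻¹)).mp hg
      rw [← conj_smul_eq_toConjAct_smul, ← conj_smul_eq_toConjAct_smul, ← mul_smul, ← map_mul] at h
      exact h
    -- `b ∈ a⁻¹ Π_v a`, so a power of `b` lies in `u Π_v u⁻¹`: `u ∈ Π_v`
    have hb' : genB ∈ MulAut.conj genA⁻¹ • vertGp := by
      rw [Subgroup.mem_smul_pointwise_iff_exists]
      refine ⟨genA * genB * genA⁻¹, conj_genB_mem_vertGp, ?_⟩
      rw [MulAut.smul_def, MulAut.conj_apply]; group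
    obtain ⟨n, hn, hbn⟩ := exists_pow_mem_of_commensurable hg' hb'
    rw [Subgroup.mem_smul_pointwise_iff_exists] at hbn
    obtain ⟨t, ht, hut⟩ := hbn
    rw [MulAut.smul_def, MulAut.conj_apply] at hut
    have huV : u ∈ vertGp := by
      have hmem : u⁻¹ * genB ^ n * u⁻¹⁻¹ ∈ vertGp := by
        rw [inv_inv, ← hut, show u⁻¹ * (u * t * u⁻¹) * u = t by group]
        exact ht
      exact (Subgroup.inv_mem_iff _).mp (hkey u⁻¹ (H.inv_mem huH) ⟨n, hn, hmem⟩)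
    -- hence `Π_v` and `a⁻¹ Π_v a` are commensurable
    rw [Subgroup.conj_smul_eq_self_of_mem huV] at hg'
    -- a power of `a⁻¹ b a` lies in `Π_v`
    have hab : genA⁻¹ * genB * genA ∈ MulAut.conj genA⁻¹ • vertGp := by
      rw [Subgroup.mem_smul_pointwise_iff_exists]
      exact ⟨genB, genB_mem_vertGp, by rw [MulAut.smul_def, MulAut.conj_apply, inv_inv]⟩
    obtain ⟨m, hm, habm⟩ := exists_pow_mem_of_commensurable hg' hab
    -- `(a⁻¹ b a)^m = (a²)⁻¹ · (a b^m a⁻¹) · a²` with `a b^m a⁻¹ ∈ Π_v`, `a² ∈ H ∖ Π_v`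
    have hz : genA * genB ^ m * genA⁻¹ ∈ vertGp := by
      rw [← conj_pow]
      exact Subgroup.pow_mem _ conj_genB_mem_vertGp m
    have e1 : (genA⁻¹ * genB * genA) ^ m = genA⁻¹ * genB ^ m * genA := by
      conv_lhs => rw [show genA⁻¹ * genB * genA = genA⁻¹ * genB * genA⁻¹⁻¹ by rw [inv_inv]]
      rw [conj_pow, inv_inv]
    have hconj : (genA * genA)⁻¹ * (genA * genB ^ m * genA⁻¹) * (genA * genA)⁻¹⁻¹ ∈ vertGp := by
      rw [show (genA * genA)⁻¹ * (genA * genB ^ m * genA⁻¹) * (genA * genA)⁻¹⁻¹ = genA⁻¹ * genB ^ m * genA by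
        group, ← e1]
      exact habm
    have h1 := hmal (genA * genA)⁻¹ _ (H.inv_mem haaH)
      (fun h => genA_sq_not_mem_vertGp ((Subgroup.inv_mem_iff _).mp h)) hz hconj
    have h2 : genB ^ m = 1 := by
      rw [show genB ^ m = genA⁻¹ * (genA * genB ^ m * genA⁻¹) * genA by group, h1]; group
    exact genB_pow_ne_one (Nat.pos_iff_ne_zero.mp hm) h2

/-- `C_{F̂₂}(Π_v) = Π_v`. [cite: MochizukiCombGC2007, Prop 1.2 p.8] -/
theorem commensurator_vertGp_eq : Subgroup.Commensurable.commensurator vertGp = vertGp :=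
  isCommensurablyTerminal_vertGp.commensurator_eq

/-! ### [CombGC] Prop 1.2 (ii) for the loop datum; [AbsTopII] Prop 1.3 (iii) rest at `dpsc`, unconditionally -/

/-- **[CombGC] Prop 1.2 (ii) — layer L3's `VerticialEdgeLikeCommensurablyTerminal` (the FACT-LIST F-0438 shape)
— HOLDS for the loop datum `DehnTwist.loopDatum` on `F̂₂`, with no hypothesis**: every verticial or edge-like
subgroup (a conjugate of `Π_v`, `Π_e = b^Ẑ` or `Π_c = c^Ẑ`) is commensurably terminal.
[cite: MochizukiCombGC2007, Prop 1.2(ii) p.8] [cite: RibesZalesskii2010, Thm. 9.1.12] -/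
theorem verticialEdgeLikeCommensurablyTerminal_loopDatum : loopDatum.VerticialEdgeLikeCommensurablyTerminal := by
  rintro A (⟨v, γ, rfl⟩ | ⟨e, γ, rfl⟩ | ⟨c, γ, rfl⟩)
  · exact SemiGraphOfAnabelioids.IsProSigmaCompletion.commensurator_smul_eq_smul isCommensurablyTerminal_vertGp γ
  · exact SemiGraphOfAnabelioids.IsProSigmaCompletion.commensurator_smul_eq_smul isCommensurablyTerminal_nodeGp γ
  · exact SemiGraphOfAnabelioids.IsProSigmaCompletion.commensurator_smul_eq_smul isCommensurablyTerminal_cuspGp γ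

section Dpsc

variable {i : ℕ} (hi : 0 < i)

/-- **[AbsTopII] Prop 1.3 (iii) rest — the typed `Prop_1_3_iii'` (F-0299) — HOLDS IN FULL at the nodal Dehn-twist
datum `dpsc i hi`, with no hypothesis** ("`D_v ∩ Π_I = I_v × Π_v`", "`I_v ≅ Ẑ^Σ`", and the cusp clause).
[cite: MochizukiAbsTopII2013, Prop 1.3 (iii) p.11] -/
theorem prop_1_3_iii'_dpsc_holds' :
    Literature.AnabelianGeometry.AbsoluteAnabelian.AbsTopII.DPSCIndexData.Prop_1_3_iii' (dpsc i hi) :=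
  prop_1_3_iii'_dpsc_of_normalizer_vertGp_eq hi isCommensurablyTerminal_vertGp.isNormallyTerminal.normalizer_eq

/-- **The scope successor `Prop_1_3_iii''` HOLDS IN FULL at the nodal Dehn-twist datum, with no hypothesis.**
[cite: MochizukiAbsTopII2013, Prop 1.3 (iii) p.11] -/
theorem prop_1_3_iii''_dpsc_holds :
    Literature.AnabelianGeometry.AbsoluteAnabelian.AbsTopII.DPSCIndexData.Prop_1_3_iii'' (dpsc i hi) :=
  prop_1_3_iii''_dpsc_of_normalizer_vertGp_eq hi isCommensurablyTerminal_vertGp.isNormallyTerminal.normalizer_eq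

/-- `D_v ∩ Π_I = I_v · Π_v` at the nodal datum (the vertex clause, now unconditional).
[cite: MochizukiAbsTopII2013, Prop 1.3 (iii) p.11] -/
theorem dv_inf_PiI_eq_dpsc (v : (dpsc i hi).Vert) :
    (dpsc i hi).Dv v ⊓ (dpsc i hi).PiI = (dpsc i hi).Iv v ⊔ (dpsc i hi).vertSub v :=
  (dv_inf_PiI_eq_iff hi v).mpr isCommensurablyTerminal_vertGp.isNormallyTerminal.normalizer_eq

end Dpsc

/-- **ONE DPSC datum WITH A NODE at which [AbsTopII] Prop 1.3 (i), (ii), (ii′), (iii) (first clause AND rest, both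
typings), (vi), (vii), (ix) ALL hold with no hypothesis, and whose PSC datum satisfies [CombGC] Prop 1.2 (ii).**
[cite: MochizukiAbsTopII2013, Prop 1.3 p.11] -/
theorem exists_nodal_model_prop13_i_ii_iii_vi_vii_ix (i : ℕ) (hi : 0 < i) :
    ∃ X : DPSCIndexData.{0}, Nonempty X.Node ∧ X.Sigma = {p | p.Prime} ∧ (∀ e : X.Node, X.sigmaIndex e = i) ∧
      Literature.AnabelianGeometry.AbsoluteAnabelian.AbsTopII.DPSCIndexData.Prop_1_3_i X ∧
      Literature.AnabelianGeometry.AbsoluteAnabelian.AbsTopII.DPSCIndexData.Prop_1_3_ii' X ∧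
      Literature.AnabelianGeometry.AbsoluteAnabelian.AbsTopII.DPSCIndexData.Prop_1_3_ii X ∧
      X.toDPSCData.Prop13iii ∧
      Literature.AnabelianGeometry.AbsoluteAnabelian.AbsTopII.DPSCIndexData.Prop_1_3_iii' X ∧
      Literature.AnabelianGeometry.AbsoluteAnabelian.AbsTopII.DPSCIndexData.Prop_1_3_iii'' X ∧
      X.toDPSCData.Prop13vi ∧ X.toDPSCData.Prop13vii ∧ X.toDPSCData.Prop13ix :=
  ⟨dpsc i hi, dpsc_node_nonempty i hi, rfl, fun _ => rfl, prop_1_3_i_dpsc_holds hi, prop_1_3_ii'_dpsc_holds hi,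
    prop_1_3_ii_dpsc_holds hi, prop13iii_dpsc_holds hi, prop_1_3_iii'_dpsc_holds' hi, prop_1_3_iii''_dpsc_holds hi,
    prop13vi_dpsc_holds hi, prop13vii_dpsc_holds hi, prop13ix_dpsc_holds hi⟩

end Literature.AnabelianGeometry.AbsoluteAnabelian.AbsTopII.DehnTwist

end
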